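import Summits.SmoothPoincare4.SmoothPoincare4.Theses.SymplecticOrigami
import Summits.SmoothPoincare4.SmoothPoincare4.Theorems.SymplecticOrigamiOrigamiRungStubPinchPieceHomeomorph
import Summits.SmoothPoincare4.SmoothPoincare4.Theorems.SymplecticOrigamiOrigamiRungStubPinchBlowdownQuotient
import Summits.SmoothPoincare4.SmoothPoincare4.Theorems.SymplecticOrigamiOrigamiRungStubPinchAlexanderAux

/-!
# Stub `stub_pinch_exceptionalNbhd` of line `pair-rigidity-endgame`
# (crux `SymplecticOrigami.OrigamiRung`)

**The exceptional neighbourhood.**  `M` is a compact boundaryless `4`-manifold, `τ : M → ℝ` smooth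
with `0` a regular level, `V` one of the sides `{τ < 0}`, `{τ > 0}`, `b : S → N` a smooth embedding
of a compact surface with image `B`, and `β : M → N` the blow-down of the piece `V` (smooth near
`closure V`, injective on `V` with image `N ∖ B` and bijective differential there,
`β (frontier V) ⊆ B`).  Then `B` has an OPEN neighbourhood `D` with `h_k(D; F) = h_k(S; F)` and
`h_k(D ∖ B; F) = h_k({τ = 0}; F)` for every field `F` and every `k`.

Proof (side `{τ > 0}`; the other side is this one for `-τ`), with a unit-speed collar field `U` of
the regular level (`LevelUnitField`, Milnor 1963 Thm. 3.1: flow `φ_t`, clock `τ (φ_t x) = τ x + t`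
on the band `τ⁻¹(-δ, δ)`).  `closure {τ > 0} = {τ ≥ 0}`, `frontier {τ > 0} = {τ = 0}` (a level
point is the limit of its flow line), so the landed `stub_pinch_blowdownQuotient` gives
`β '' {τ = 0} = B` and a quotient map `β| : {τ ≥ 0} → N`, whose fibres are points or pairs of
level points.  `D := β '' Y` for the SATURATED half-open collar `Y = {0 ≤ τ < δ}`: `D` is open,
`B ⊆ D`, and `β| : Y → D` is again a quotient map (a closed map, by compactness and saturation).
`D ∖ B = β '' {0 < τ < δ} ≅ {0 < τ < δ}` (a continuous open injection, by the inverse function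
theorem) `≃ {τ = 0}` (flow-out of the level / Milnor's drop), whence the second count.  The
radial deformation `(s, x) ↦ φ_{-s τ x}(x)` of `Y` onto the level fixes the level, so it is
constant on the fibres of `β|Y` and DESCENDS through the quotient map (`[0, 1]` is locally
compact) to a deformation retraction of `D` onto `B ≅ S`, whence the first count (homotopy
invariance, Hatcher 2002 Cor. 2.11).  Everything is proved; all folklore.
-/

noncomputable section

-- the prescribed namespace `Summit.<P>.<Sub>.…` duplicates `SmoothPoincare4` (P = Sub)
set_option linter.dupNamespace false

open scoped Manifold ContDiff Topology ContinuousMap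
open Set TopologicalSpace

namespace Summit.SmoothPoincare4.SmoothPoincare4.Theorems.OrigamiRung.PairRigidityEndgame

open Function Topology
open Literature.Topology.FourManifolds (LevelUnitField IsRegularLevel)
open Literature.AlgebraicTopology.SingularHomology (singularHomology)

/-- Model space `ℝⁿ` (file-local notation, as in the sibling stub files and the skeleton). -/
local notation "𝔼" n:arg => EuclideanSpace ℝ (Fin n)

namespace PinchCollar

/-! ### General topology: a saturated piece of a compact quotient; descending a deformation -/

section Topology

variable {X N : Type*} [TopologicalSpace X] [TopologicalSpace N]

/-- **A saturated piece of a map on a compact set is a quotient map onto its image.**  If `β` is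
continuous on the closed set `W` of the compact space `X`, `Y ⊆ W`, and `Y` is saturated for
`β|W` (a point of `W` with the same image as a point of `Y` lies in `Y`), then `β| : Y → β '' Y`
is a closed map (a closed set of `Y` is the trace of a compact `C ⊆ W`, and its image is the
trace of the compact `β '' C`), hence a quotient map. [folklore] -/
theorem isQuotientMap_imageFactorization [CompactSpace X] [T2Space N] {W Y : Set X} {β : X → N}
    (hW : IsClosed W) (hβ : ContinuousOn β W) (hYW : Y ⊆ W)
    (hsat : ∀ x ∈ W, ∀ x' ∈ Y, β x = β x' → x ∈ Y) :
    IsQuotientMap (imageFactorization β Y) := by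
  have hcont : Continuous (imageFactorization β Y) :=
    (continuousOn_iff_continuous_restrict.1 (hβ.mono hYW)).subtype_mk _
  refine IsClosedMap.isQuotientMap (fun C hC => ?_) hcont imageFactorization_surjective
  obtain ⟨C', hC', rfl⟩ := isClosed_induced_iff.1 hC
  have hK : IsClosed (β '' (C' ∩ W)) :=
    (((hC'.inter hW).isCompact).image_of_continuousOn (hβ.mono inter_subset_right)).isClosed
  convert hK.preimage continuous_subtype_val using 1
  ext ⟨y, hy⟩
  refine ⟨?_, ?_⟩
  · rintro ⟨⟨x, hxY⟩, hxC, hxy⟩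
    exact ⟨x, ⟨hxC, hYW hxY⟩, congrArg Subtype.val hxy⟩
  · rintro ⟨x, ⟨hxC, hxW⟩, hxy⟩
    obtain ⟨x', hx', hx'y⟩ := hy
    exact ⟨⟨x, hsat x hxW x' hx' (hxy.trans hx'y.symm)⟩, hxC, Subtype.ext hxy⟩

/-- **Descending a deformation retraction through a quotient map.**  Let `q : Y → D` be a
quotient map onto `D ⊆ N` whose fibres are points or lie in `Z ⊆ Y`, with `q '' Z = B ⊆ D`, and
let `H` be a deformation of `Y` into `Z` (`H₀ = id`, `H₁(Y) ⊆ Z`) fixing `Z` pointwise at all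
times.  Then `H` is constant on the fibres of `q` at every time, so it descends to a homotopy
`[0, 1] × D → D` (`IsQuotientMap.continuous_lift_prod_right`: `[0, 1]` is locally compact) from
the identity to `D → B ↪ D`, a left inverse of `B ↪ D` (Hatcher 2002, Ch. 0). [folklore] -/
theorem nonempty_homotopyEquiv_of_descend {Y : Type*} [TopologicalSpace Y] {D B : Set N}
    {q : Y → D} (hq : IsQuotientMap q) {Z : Set Y} (hBD : B ⊆ D)
    (hqZ : ∀ z ∈ Z, (q z : N) ∈ B) (hBq : ∀ y ∈ B, ∃ z ∈ Z, (q z : N) = y)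
    (hfib : ∀ x x', q x = q x' → x = x' ∨ (x ∈ Z ∧ x' ∈ Z))
    (H : C(unitInterval × Y, Y)) (h0 : ∀ x, H (0, x) = x) (h1 : ∀ x, H (1, x) ∈ Z)
    (hZ : ∀ s, ∀ z ∈ Z, H (s, z) = z) : Nonempty (B ≃ₕ D) := by
  choose sec hsec using hq.surjective
  -- the deformation is compatible with the fibres of `q`
  have hwd : ∀ (s : unitInterval) (x x' : Y), q x = q x' → q (H (s, x)) = q (H (s, x')) := by
    intro s x x' h
    rcases hfib x x' h with rfl | ⟨hx, hx'⟩
    · rfl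
    · rw [hZ s x hx, hZ s x' hx', h]
  have hG : Continuous fun p : unitInterval × D => q (H (p.1, sec p.2)) := by
    refine hq.continuous_lift_prod_right ?_
    have : (fun p : unitInterval × Y => q (H (p.1, sec (q p.2)))) = fun p => q (H p) :=
      funext fun p => hwd p.1 _ _ (hsec (q p.2))
    rw [this]
    exact hq.continuous.comp H.continuous
  let ρ : C(D, B) := ⟨fun y => ⟨(q (H (1, sec y)) : N), hqZ _ (h1 _)⟩,
    (continuous_subtype_val.comp (hG.comp (continuous_const.prodMk continuous_id))).subtype_mk _⟩
  have hρ : ρ.comp (ContinuousMap.inclusion hBD) = ContinuousMap.id B := by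
    ext y
    obtain ⟨z, hz, hzy⟩ := hBq y y.2
    have hqz : q z = Set.inclusion hBD y := Subtype.ext hzy
    calc (q (H (1, sec (Set.inclusion hBD y))) : N) = q (H (1, z)) :=
        congrArg Subtype.val (hwd 1 _ z ((hsec _).trans hqz.symm))
      _ = y := by rw [hZ 1 z hz]; exact hzy
  refine ⟨{ toFun := ContinuousMap.inclusion hBD
            invFun := ρ
            left_inv := by rw [hρ]
            right_inv := ContinuousMap.Homotopic.symm ⟨
              { toFun := fun p => q (H (p.1, sec p.2))
                continuous_toFun := hG
                map_zero_left := fun y => by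
                  show q (H (0, sec y)) = y
                  rw [h0, hsec]
                map_one_left := fun _ => rfl }⟩ }⟩

end Topology

/-! ### The collar flow of the regular level -/

section Flow

variable {M : Type} [TopologicalSpace M] [T2Space M] [CompactSpace M]
  [ChartedSpace (𝔼 4) M] [IsManifold (𝓡 4) ∞ M] {τ : M → ℝ} (U : LevelUnitField 3 τ 0)

include U in
/-- **The closure of the open side `{τ > 0}` of a collared level is `{τ ≥ 0}`**: a level point
`x` is the limit of its flow line `φ_t(x)`, `t ↓ 0`, along which `τ = t > 0` (Milnor's clock).
[folklore] -/
theorem closure_pos_eq : closure {x : M | 0 < τ x} = {x | 0 ≤ τ x} := by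
  refine Subset.antisymm (closure_minimal (fun x (hx : 0 < τ x) => hx.le)
    (isClosed_le continuous_const U.contMDiff_f.continuous)) fun x (hx : 0 ≤ τ x) => ?_
  rcases hx.lt_or_eq with hx | hx
  · exact subset_closure hx
  · have hc : Continuous fun t : ℝ => U.fl x t :=
      U.continuous_fl.comp (continuous_const.prodMk continuous_id)
    have ht : Filter.Tendsto (fun t : ℝ => U.fl x t) (𝓝[>] 0) (𝓝 x) := by
      simpa only [LevelUnitField.fl_zero] using (hc.tendsto 0).mono_left nhdsWithin_le_nhds
    refine mem_closure_of_tendsto ht ?_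
    filter_upwards [Ioo_mem_nhdsGT U.δ_pos] with t ht
    show 0 < τ (U.fl x t)
    rw [U.apply_fl_of_apply_eq hx.symm ⟨by linarith [ht.1, U.δ_pos], ht.2⟩]
    linarith [ht.1]

include U in
/-- **The frontier of the open side `{τ > 0}` of a collared level is the level `{τ = 0}`**
(`frontier = closure ∖ interior`). [folklore] -/
theorem frontier_pos_eq : frontier {x : M | 0 < τ x} = {x | τ x = 0} := by
  rw [frontier, closure_pos_eq U,
    (isOpen_lt continuous_const U.contMDiff_f.continuous).interior_eq]
  ext x
  simp only [mem_sdiff, mem_setOf_eq, not_lt]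
  exact ⟨fun h => le_antisymm h.2 h.1, fun h => ⟨h.ge, h.le⟩⟩

/-- **The level is homotopy equivalent to the half band** `{0 < τ < ε}`, `0 < ε ≤ δ`: flow out of
the level to height `ε / 2`; a homotopy inverse is Milnor's drop `ψ_x(0)`, which undoes the
flow-out exactly, while `(s, x) ↦ ψ_x((1 - s) τ x + s ε / 2)` joins the identity to the other
composite inside the half band. [folklore] -/
theorem nonempty_halfBandHomotopyEquiv {ε : ℝ} (hε : 0 < ε) (hεδ : ε ≤ U.δ) :
    Nonempty (↥{x : M | τ x = 0} ≃ₕ ↥({x : M | 0 < τ x} ∩ {x | τ x < ε})) := by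
  have hτ : Continuous τ := U.contMDiff_f.continuous
  have hup : ∀ {y : M}, τ y = 0 → ∀ {c : ℝ}, 0 < c → c < ε →
      U.fl y c ∈ ({x : M | 0 < τ x} ∩ {x | τ x < ε}) := fun hy c hc hcε => by
    have h := U.apply_fl_of_apply_eq hy ⟨by linarith [U.δ_pos], by linarith⟩
    exact ⟨show 0 < τ (U.fl _ c) by rw [h]; linarith, show τ (U.fl _ c) < ε by rw [h]; linarith⟩
  have hdrop : ∀ {x : M}, x ∈ ({x : M | 0 < τ x} ∩ {x | τ x < ε}) → τ (U.drop x) = 0 := by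
    intro x hx
    obtain ⟨hx0, hx1⟩ : 0 < τ x ∧ τ x < ε := hx
    exact U.apply_drop ⟨by linarith [U.δ_pos], by linarith⟩
  have hc : ∀ {x : M}, x ∈ ({x : M | 0 < τ x} ∩ {x | τ x < ε}) → ∀ {s : ℝ}, s ∈ Icc (0 : ℝ) 1 →
      0 < (1 - s) * τ x + s * (ε / 2) ∧ (1 - s) * τ x + s * (ε / 2) < ε := by
    intro x hx s hs
    obtain ⟨hx0, hx1⟩ : 0 < τ x ∧ τ x < ε := hx
    exact ⟨by linarith [lt_min hx0 (half_pos hε),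
        mul_le_mul_of_nonneg_left (min_le_left (τ x) (ε / 2)) (sub_nonneg.2 hs.2),
        mul_le_mul_of_nonneg_left (min_le_right (τ x) (ε / 2)) hs.1],
      by linarith [max_lt hx1 (half_lt_self hε),
        mul_le_mul_of_nonneg_left (le_max_left (τ x) (ε / 2)) (sub_nonneg.2 hs.2),
        mul_le_mul_of_nonneg_left (le_max_right (τ x) (ε / 2)) hs.1]⟩
  have hε2 : ε / 2 ∈ Ioo (-U.δ) U.δ := ⟨by linarith, by linarith⟩
  refine ⟨{ toFun := ⟨fun y => ⟨U.fl y (ε / 2), hup y.2 (half_pos hε) (half_lt_self hε)⟩,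
              (U.continuous_fl.comp (continuous_subtype_val.prodMk continuous_const)).subtype_mk _⟩
            invFun := ⟨fun x => ⟨U.drop x, hdrop x.2⟩,
              (U.continuous_drop.comp continuous_subtype_val).subtype_mk _⟩
            left_inv := ⟨(ContinuousMap.Homotopy.refl _).cast (by
              ext y
              exact (U.drop_fl_of_apply_eq y.2 hε2).symm) rfl⟩
            right_inv := ContinuousMap.Homotopic.symm ⟨
              { toFun := fun p => ⟨U.fl (U.drop (p.2 : M))
                    ((1 - (p.1 : ℝ)) * τ p.2 + (p.1 : ℝ) * (ε / 2)),
                  hup (hdrop p.2.2) (hc p.2.2 ⟨p.1.2.1, p.1.2.2⟩).1 (hc p.2.2 ⟨p.1.2.1, p.1.2.2⟩).2⟩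
                continuous_toFun := (U.continuous_fl.comp
                  ((U.continuous_drop.comp (continuous_subtype_val.comp continuous_snd)).prodMk
                    (by fun_prop))).subtype_mk _
                map_zero_left := fun x => by ext; simpa using U.fl_drop (x : M)
                map_one_left := fun x => by
                  ext
                  show U.fl (U.drop (x : M)) ((1 - ((1 : unitInterval) : ℝ)) * τ x +
                    ((1 : unitInterval) : ℝ) * (ε / 2)) = U.fl (U.drop x) (ε / 2)
                  simp }⟩ }⟩

/-- The radial deformation `φ_{-s τ x}(x)`, `s ∈ [0, 1]`, of the half-open collar
`Y = {0 ≤ τ < δ}`: its clock is `(1 - s) τ x` and it stays in `Y`. [folklore] -/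
theorem fl_neg_mul_mem_collar {x : M} (hx : x ∈ ({x : M | 0 ≤ τ x} ∩ {x | τ x < U.δ})) {s : ℝ}
    (hs : s ∈ Icc (0 : ℝ) 1) :
    τ (U.fl x (-(s * τ x))) = τ x - s * τ x ∧
      U.fl x (-(s * τ x)) ∈ ({x : M | 0 ≤ τ x} ∩ {x | τ x < U.δ}) := by
  obtain ⟨hx0, hx1⟩ : 0 ≤ τ x ∧ τ x < U.δ := hx
  have h := PinchFlow.apply_fl_neg_mul U le_rfl ⟨hx1, show -U.δ < τ x by linarith [U.δ_pos]⟩ hs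
  refine ⟨h, show 0 ≤ τ (U.fl x _) from ?_, show τ (U.fl x _) < U.δ from ?_⟩
  · rw [h]; linarith [mul_le_of_le_one_left hx0 hs.2]
  · rw [h]; linarith [mul_nonneg hs.1 hx0]

end Flow

end PinchCollar

/-! ### The stub -/

/-- **The exceptional neighbourhood, side `{τ > 0}`.**  For a collared level `{τ = 0}` of the
compact `4`-manifold `M`, a smooth embedding `b : S → N` of a compact surface and a blow-down
`β` of the side `{τ > 0}` (smooth near `{τ ≥ 0}`, injective on `{τ > 0}` with image `(range b)ᶜ`
and bijective differential there, `β (frontier {τ > 0}) ⊆ range b`): the image `D` of the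
half-open collar `{0 ≤ τ < δ}` is an open neighbourhood of `range b` with `h_k(D) = h_k(S)` and
`h_k(D ∖ range b) = h_k({τ = 0})` over every field (see the module docstring). [folklore] -/
theorem stub_pinch_exceptionalNbhd_pos {M : Type} [TopologicalSpace M] [T2Space M]
    [CompactSpace M] [ChartedSpace (𝔼 4) M] [IsManifold (𝓡 4) ∞ M] {N : Type}
    [TopologicalSpace N] [T2Space N] [ChartedSpace (𝔼 4) N] [IsManifold (𝓡 4) ∞ N] {S : Type}
    [TopologicalSpace S] [CompactSpace S] [ChartedSpace (𝔼 2) S] [IsManifold (𝓡 2) ∞ S]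
    {τ : M → ℝ} (U : LevelUnitField 3 τ 0) {b : S → N} {β : M → N}
    (hb : Manifold.IsSmoothEmbedding (𝓡 2) (𝓡 4) ∞ b)
    (hβU : ∃ O : Set M, IsOpen O ∧ closure {x | 0 < τ x} ⊆ O ∧ ContMDiffOn (𝓡 4) (𝓡 4) ∞ β O)
    (hinj : InjOn β {x | 0 < τ x}) (himg : β '' {x | 0 < τ x} = (range b)ᶜ)
    (hbij : ∀ x ∈ {x : M | 0 < τ x}, Bijective (mfderiv (𝓡 4) (𝓡 4) β x))
    (hfr : β '' frontier {x | 0 < τ x} ⊆ range b) :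
    ∃ D : Set N, IsOpen D ∧ range b ⊆ D ∧ ∀ (F : Type) [Field F] (k : ℕ),
      Module.finrank F (singularHomology F F ↥D k) = Module.finrank F (singularHomology F F S k) ∧
        Module.finrank F (singularHomology F F ↥(D \ range b) k) =
          Module.finrank F (singularHomology F F ↥{x : M | τ x = 0} k) := by
  obtain ⟨O, hOo, hclO, hβO⟩ := hβU
  have hτ : Continuous τ := U.contMDiff_f.continuous
  have hVo : IsOpen {x : M | 0 < τ x} := isOpen_lt continuous_const hτ
  -- the landed blow-down facts: `β` folds the level onto `B`, `β|{τ ≥ 0}` is a quotient map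
  obtain ⟨-, hfrB, hq⟩ : β '' closure {x : M | 0 < τ x} = univ ∧
      β '' frontier {x : M | 0 < τ x} = range b ∧
      IsQuotientMap ((closure {x : M | 0 < τ x}).restrict β) :=
    stub_pinch_blowdownQuotient M N S ⟨_, hVo⟩ b β hb ⟨O, hOo, hclO, hβO.continuousOn⟩ himg hfr
  rw [PinchCollar.frontier_pos_eq U] at hfrB; rw [PinchCollar.closure_pos_eq U] at hq hclO
  have hβW : ContinuousOn β {x | 0 ≤ τ x} := hβO.continuousOn.mono hclO
  -- the fibres of `β` over `{τ ≥ 0}`: points, or pairs of level points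
  have hZB : ∀ x, τ x = 0 → β x ∈ range b := fun x hx => hfrB ▸ mem_image_of_mem β hx
  have hV : ∀ x, 0 < τ x → β x ∉ range b := fun x hx h =>
    (show β x ∈ (range b)ᶜ by rw [← himg]; exact mem_image_of_mem β hx) h
  have hfib : ∀ x x', 0 ≤ τ x → 0 ≤ τ x' → β x = β x' → x = x' ∨ (τ x = 0 ∧ τ x' = 0) := by
    intro x x' hx hx' h
    rcases hx.lt_or_eq with hx | hx <;> rcases hx'.lt_or_eq with hx' | hx'
    · exact Or.inl (hinj hx hx' h)
    · exact absurd (hZB x' hx'.symm) (by rw [← h]; exact hV x hx)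
    · exact absurd (hZB x hx.symm) (by rw [h]; exact hV x' hx')
    · exact Or.inr ⟨hx.symm, hx'.symm⟩
  -- the half-open collar `Y`, saturated for `β|{τ ≥ 0}`, and its open image `D ⊇ B`
  set Y : Set M := {x | 0 ≤ τ x} ∩ {x | τ x < U.δ}
  have hsat : ∀ x, 0 ≤ τ x → ∀ x' ∈ Y, β x = β x' → x ∈ Y := by
    intro x hx x' hx' h
    rcases hfib x x' hx hx'.1 h with rfl | ⟨h0, -⟩
    · exact hx'
    · exact ⟨hx, show τ x < U.δ by rw [h0]; exact U.δ_pos⟩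
  have hDo : IsOpen (β '' Y) := by
    refine hq.isOpen_preimage.1 ?_
    have : (Set.restrict {x : M | 0 ≤ τ x} β) ⁻¹' (β '' Y) = Subtype.val ⁻¹' {x | τ x < U.δ} := by
      ext ⟨x, hx⟩
      refine ⟨?_, fun hxT => ⟨x, ⟨hx, hxT⟩, rfl⟩⟩
      rintro ⟨x', hx', hxx'⟩
      exact (hsat x hx x' hx' hxx'.symm).2
    rw [this]
    exact (isOpen_lt hτ continuous_const).preimage continuous_subtype_val
  have hBZ : ∀ y ∈ range b, ∃ x, τ x = 0 ∧ x ∈ Y ∧ β x = y := fun y hy => by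
    obtain ⟨x, hx, rfl⟩ : y ∈ β '' {x | τ x = 0} := by rw [hfrB]; exact hy
    have hx : τ x = 0 := hx
    exact ⟨x, hx, ⟨hx.ge, show τ x < U.δ by rw [hx]; exact U.δ_pos⟩, rfl⟩
  have hBD : range b ⊆ β '' Y := fun y hy => by
    obtain ⟨x, -, hxY, rfl⟩ := hBZ y hy
    exact mem_image_of_mem β hxY
  -- (1) `B ↪ D` is a homotopy equivalence: descend the radial deformation of `Y`
  have hqY : IsQuotientMap (imageFactorization β Y) :=
    PinchCollar.isQuotientMap_imageFactorization (isClosed_le continuous_const hτ) hβW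
      inter_subset_left (fun x hx x' hx' h => hsat x hx x' hx' h)
  let H : C(unitInterval × ↥Y, ↥Y) :=
    ⟨fun p => ⟨U.fl p.2 (-(p.1 * τ p.2)),
        (PinchCollar.fl_neg_mul_mem_collar U p.2.2 ⟨p.1.2.1, p.1.2.2⟩).2⟩,
      (U.continuous_fl.comp ((continuous_subtype_val.comp continuous_snd).prodMk
        (((continuous_subtype_val.comp continuous_fst).mul
          (hτ.comp (continuous_subtype_val.comp continuous_snd))).neg))).subtype_mk _⟩
  obtain ⟨eBD⟩ := PinchCollar.nonempty_homotopyEquiv_of_descend (B := range b) hqY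
    (Z := {x : ↥Y | τ x = 0}) hBD (fun z hz => hZB z hz)
    (fun y hy => by
      obtain ⟨x, hx, hxY, rfl⟩ := hBZ y hy
      exact ⟨⟨x, hxY⟩, hx, rfl⟩)
    (fun x x' h => (hfib x x' x.2.1 x'.2.1 (congrArg Subtype.val h)).imp Subtype.ext id)
    H (fun x => Subtype.ext (by
      show U.fl (x : M) (-((0 : unitInterval) * τ x)) = x
      simp))
    (fun x => by
      show τ (U.fl (x : M) (-((1 : unitInterval) * τ x))) = 0
      rw [Set.Icc.coe_one, (PinchCollar.fl_neg_mul_mem_collar U x.2 ⟨zero_le_one, le_rfl⟩).1]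
      ring)
    (fun s z hz => Subtype.ext (by
      show U.fl (z : M) (-(s * τ z)) = z
      rw [show τ (z : M) = 0 from hz, mul_zero, neg_zero, LevelUnitField.fl_zero]))
  have eSD : S ≃ₕ ↥(β '' Y) := hb.isEmbedding.toHomeomorph.toHomotopyEquiv.trans eBD
  -- (2) the complement: `D ∖ B = β '' {0 < τ < δ} ≅ {0 < τ < δ} ≃ {τ = 0}`
  have hA : β '' ({x | 0 < τ x} ∩ {x | τ x < U.δ}) = β '' Y \ range b := by
    refine Subset.antisymm ?_ ?_
    · rintro _ ⟨x, ⟨hx0, hx1⟩, rfl⟩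
      have hx0 : 0 < τ x := hx0
      exact ⟨⟨x, ⟨(hx0.le : 0 ≤ τ x), hx1⟩, rfl⟩, hV x hx0⟩
    · rintro _ ⟨⟨x, hx, rfl⟩, hxB⟩
      have hx0 : 0 ≤ τ x := hx.1
      exact ⟨x, ⟨hx0.lt_of_ne fun h => hxB (hZB x h.symm), hx.2⟩, rfl⟩
  have hAo : IsOpen ({x | 0 < τ x} ∩ {x | τ x < U.δ}) := hVo.inter (isOpen_lt hτ continuous_const)
  have hemb : IsOpenEmbedding (({x | 0 < τ x} ∩ {x | τ x < U.δ}).restrict β) := by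
    refine IsOpenEmbedding.of_continuous_injective_isOpenMap
      (continuousOn_iff_continuous_restrict.1
        (hβW.mono fun x (hx : 0 < τ x ∧ τ x < U.δ) => (hx.1.le : 0 ≤ τ x)))
      (injOn_iff_injective.1 (hinj.mono inter_subset_left)) fun O' hO' => ?_
    rw [show ({x | 0 < τ x} ∩ {x | τ x < U.δ}).restrict β '' O' = β '' (Subtype.val '' O') by
      rw [image_image]; rfl]
    exact isOpen_image_of_mfderiv_bijective hVo (hβO.mono fun x (hx : 0 < τ x) => hclO hx.le)
      hbij (hAo.isOpenMap_subtype_val O' hO')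
      ((Subtype.coe_image_subset _ O').trans inter_subset_left)
  have eA : ↥({x | 0 < τ x} ∩ {x | τ x < U.δ}) ≃ₜ ↥(β '' Y \ range b) :=
    hemb.isEmbedding.toHomeomorph.trans (Homeomorph.setCongr (by rw [range_restrict, hA]))
  obtain ⟨eZ⟩ := PinchCollar.nonempty_halfBandHomotopyEquiv U U.δ_pos le_rfl
  refine ⟨β '' Y, hDo, hBD, fun F _ k => ⟨?_, ?_⟩⟩
  · exact (singularHomology.isoOfHomotopyEquiv F F eSD k).toLinearEquiv.finrank_eq.symm
  · exact ((singularHomology.isoOfHomotopyEquiv F F eZ k).trans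
      (singularHomology.mapIso F F eA k)).toLinearEquiv.finrank_eq.symm

/-- **Stub P3 — the exceptional neighbourhood (interface `M ↔ N`).**  `M` compact connected
boundaryless `4`-manifold, `τ : M → ℝ` smooth with `0` a regular level, `V` one of its two sides,
`b : S → N` a smooth embedding of a compact connected surface into a closed connected `4`-manifold,
`β : M → N` the blow-down of the piece `V` (smooth near `closure V`, injective on `V` with image
`N ∖ B`, `B = range b`, bijective differential there, `β (frontier V) ⊆ B`).  Then `B` has an
OPEN neighbourhood `D` with `h_k(D; F) = h_k(S; F)` and `h_k(D ∖ B; F) = h_k({τ = 0}; F)` for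
every field `F` and every `k` (`stub_pinch_exceptionalNbhd_pos` for `τ` or `-τ`). [folklore] -/
theorem stub_pinch_exceptionalNbhd :
    ∀ (M : Type) [TopologicalSpace M] [T2Space M] [SecondCountableTopology M] [CompactSpace M]
      [ConnectedSpace M] [ChartedSpace (𝔼 4) M] [IsManifold (𝓡 4) ∞ M]
      (N : Type) [TopologicalSpace N] [T2Space N] [SecondCountableTopology N] [CompactSpace N]
      [ConnectedSpace N] [ChartedSpace (𝔼 4) N] [IsManifold (𝓡 4) ∞ N]
      (S : Type) [TopologicalSpace S] [CompactSpace S] [ConnectedSpace S] [ChartedSpace (𝔼 2) S]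
      [IsManifold (𝓡 2) ∞ S]
      (τ : M → ℝ) (V : Set M) (b : S → N) (β : M → N),
      ContMDiff (𝓡 4) 𝓘(ℝ, ℝ) ∞ τ → (∀ x, τ x = 0 → mfderiv (𝓡 4) 𝓘(ℝ, ℝ) τ x ≠ 0) →
      (V = {x : M | τ x < 0} ∨ V = {x : M | 0 < τ x}) →
      Manifold.IsSmoothEmbedding (𝓡 2) (𝓡 4) ∞ b →
      (∃ U : Set M, IsOpen U ∧ closure V ⊆ U ∧ ContMDiffOn (𝓡 4) (𝓡 4) ∞ β U) →
      Set.InjOn β V → β '' V = (Set.range b)ᶜ →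
      (∀ x ∈ V, Function.Bijective (mfderiv (𝓡 4) (𝓡 4) β x)) →
      β '' frontier V ⊆ Set.range b →
      ∃ D : Set N, IsOpen D ∧ Set.range b ⊆ D ∧
        ∀ (F : Type) [Field F] (k : ℕ),
          Module.finrank F (singularHomology F F ↥D k) =
              Module.finrank F (singularHomology F F S k) ∧
            Module.finrank F (singularHomology F F ↥(D \ Set.range b) k) =
              Module.finrank F (singularHomology F F ↥{x : M | τ x = 0} k) := by
  intro M _ _ _ _ _ _ _ N _ _ _ _ _ _ _ S _ _ _ _ _ τ V b β hτ hreg hV hb hβU hinj himg hbij hfr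
  -- a regular level of a smooth function on a closed manifold carries a unit-speed collar field
  have hlev : ∀ σ : M → ℝ, ContMDiff (𝓡 4) 𝓘(ℝ, ℝ) ∞ σ →
      (∀ x, σ x = 0 → mfderiv (𝓡 4) 𝓘(ℝ, ℝ) σ x ≠ 0) → Nonempty (LevelUnitField 3 σ 0) :=
    fun σ hσ hσreg =>
      (⟨hσ, fun x _ => BoundarylessManifold.isInteriorPoint' x, fun x hx => hσreg x hx⟩ :
        IsRegularLevel (𝓡 4) σ 0).exists_levelUnitField
  rcases hV with rfl | rfl
  · -- the side `{τ < 0} = {-τ > 0}`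
    have hreg' : ∀ x, (-τ) x = 0 → mfderiv (𝓡 4) 𝓘(ℝ, ℝ) (-τ) x ≠ 0 := fun x hx h =>
      hreg x (by simpa using hx) (neg_eq_zero.mp ((mfderiv_neg :
        mfderiv (𝓡 4) 𝓘(ℝ, ℝ) (-τ) x = -mfderiv (𝓡 4) 𝓘(ℝ, ℝ) τ x).symm.trans h))
    obtain ⟨U⟩ := hlev (-τ) hτ.neg hreg'
    have hA : {x : M | τ x < 0} = {x | 0 < (-τ) x} := by ext; simp
    rw [hA] at hβU hinj himg hbij hfr
    obtain ⟨D, hDo, hBD, hD⟩ := stub_pinch_exceptionalNbhd_pos U hb hβU hinj himg hbij hfr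
    rw [show {x : M | (-τ) x = 0} = {x | τ x = 0} by ext; simp] at hD
    exact ⟨D, hDo, hBD, hD⟩
  · obtain ⟨U⟩ := hlev τ hτ hreg
    exact stub_pinch_exceptionalNbhd_pos U hb hβU hinj himg hbij hfr

end Summit.SmoothPoincare4.SmoothPoincare4.Theorems.OrigamiRung.PairRigidityEndgame

end
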